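import Summits.QuantumFields.BalabanUV.Beta.EriceRemainderEnclosureHistoryAutonomyComparisonAgeCompositionThreeAgesMassCap

/-!
# EriceRemainderEnclosureHistoryAutonomyComparisonAgeCompositionInteriorPins — (E113e) route (N), first order: AT INTERIOR PINS THE YOUNG END IS CAPPED.
# Along every admissible flow, at a pin `m ≥ 1` the level dominates the previous increment, `a_m = a_{m−1} + B_{m−1} > B_{m−1} ≥ B_m ≥ B_{m+1} ≥ …`
# (`a = 1∕h²`), hence `a_{m+k} ≤ (k+1)·a_m`, i.e. the level ratio of (E89b) `window_load_le` is bounded BELOW: `(h(m+k)∕h(m))² ≥ 1∕(k+1)`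
# (**`ratio_sq_ge_interior`**).  Since (E89b)'s cap `x_k(m) ≤ ½·√(2−r)·(1−r)` (`r = (h(m+k)∕h(m))²`) decreases in `r`, every age `k` carries at an interior pin at
# most `½·√((2k+1)∕(k+1))·k∕(k+1)` (**`window_load_le_interior`**): `0.3062` (`k = 1`, **`young_load_le_interior`**: `≤ √6∕8`), `0.430` (`k = 2`), `0.496`
# (`k = 3`), … `→ √2∕2` — against `√2∕2 = 0.707` for EVERY age at the infrared pin ((E89b) `window_load_le_sqrt_two_div_two`, sharp there).  And the TOP
# ENTRY (lag-zero mass) `F(m) = Σ_k L_kh(m+k)³∕2` is `≤ ½` at every interior pin (**`top_entry_le_half_interior`**: the budget of the previous scale,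
# `Σ_k L_kh(m+k) ≤ B_{m−1} < a_m < a_{m+1}`).  WHY (README `HOME/b2b-balaban-beta-d4-p2/g94/README.md` §2, §5): the total window load exceeds `1` only
# through a SATURATED YOUNG AGE sharing the pin's increment with a receding old age ((E113c): `T(0) = 1.08`, `sup T(0) → (1+√2)∕2`); at interior pins the
# young age is capped at `0.31` and numerically `sup T(m) = 0.56…0.66` (`K ≤ 1024`), `≤ 0.76` (`K ≤ 16384`): the excess over one is an INFRARED-PIN phenomenon,
# and the light-load END (E86i) already holds from the first interior pin on, at these ranges.  These are the structural inputs of the successor's item (2)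
# «`T ≤ 1` at interior pins for a fixed range».

Cell `pub-balaban`, β-function sub-cell, BINDER row D4 «RemainderConst leaves for Bałaban's split» (`HOME/BINDER-OWNERS.md`; owner lineage `b2b-balaban-beta-an4`;
this file by co-owner #2 lineage `b2b-balaban-beta-d4-p2`, generation 94), β-FLOW TEAM duty (1), FREEZE (0) honoured (def-free; imports (E89b); uses (E89b)
`window_load_le`, `window_ratio_sq_le`, (E75) `increment_anti`, (E79) `strictAnti_of_memFlow` BY NAME; nothing restated).

HONEST FRAMING (page 1, verbatim and binding).  *"Discharging BetaPertH makes Bałaban's UV stability UNCONDITIONAL — a real constructive-QFT result; it is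
NOT the continuum limit and NOT the Clay problem."*  THIS FILE DISCHARGES NOTHING OF THE KIND.  Elementary real analysis about ABSTRACT functionals on a box
]0,γ]^ℕ with displayed floors, profiles and signs, and the FIRST-ORDER renewal objects of route (N) built from them — hypotheses of a census, not facts; the
form, signs, ages and moments of Bałaban's (1.22) limit functional are NOT PRINTED ([I] p. 298; GAPS G-t4-U2-1∕-2) and NOT asserted.  Row D4 class
UNCHANGED (critical-path width 0; instance 0∕1; D4 DISCHARGE NO DATE).  HONEST DEPENDENCY: continuum YM on T⁴ ⇐ BetaPertH ∧ nine spine estimates (0/9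
proved); BetaPertH ⇐ (D1) ∧ (D4) ∧ CAP+tail; G-an2-4 gates asym, D1 and NE2/3/4.

NOT CLAIMED: `T(m) ≤ 1` at interior pins for every profile (OPEN, README §6 (2); numerically `≤ 0.76` to range 16384); anything printed — NOT B12 Thm 2, NOT
BetaPertH.

WHAT IS PROVED ([folklore]; 0 `def`, 0 sorry).  §1 `invSq_window_le_mul_first` (`a_{m+k} − a_m ≤ k·(a_{m+1} − a_m)`), `first_increment_le_level`
(`a_{m+1} − a_m ≤ a_m` for `m ≥ 1`), **`ratio_sq_ge_interior`**.  §2 **`window_load_le_interior`**, **`young_load_le_interior`**.  §3 **`top_entry_le_half_interior`**.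
-/
noncomputable section
open Finset

namespace Summit.QuantumFields.BalabanUV.Beta.EriceRemainderEnclosureHistoryAutonomyComparisonAgeCompositionInteriorPins

open Literature.MathematicalPhysics.QuantumFieldTheory.Balaban1983to89
open Literature.MathematicalPhysics.QuantumFieldTheory.Balaban1983to89.T4BetaStationary
open Literature.MathematicalPhysics.QuantumFieldTheory.Balaban1983to89.T4BetaFlowWellPosed
open Summit.QuantumFields.BalabanUV.Beta.EriceRemainderEnclosureHistoryAutonomyOrder (strictAnti_of_memFlow)
open Summit.QuantumFields.BalabanUV.Beta.EriceRemainderEnclosureHistoryAutonomyComparisonAffineProfile (increment_anti)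
open Summit.QuantumFields.BalabanUV.Beta.EriceRemainderEnclosureHistoryAutonomyComparisonAgeCompositionThreeAgesMassCap (window_load_le window_ratio_sq_le)

variable {B : (ℕ → ℝ) → ℝ} {γ b gIR : ℝ} {L : ℕ → ℝ} {K : ℕ} {h : ℕ → ℝ}

/-! ## §1 Level geometry at an interior pin -/

/-- **THE WINDOW RISES AT MOST `k` TIMES ITS FIRST INCREMENT** (increments non-increasing): `1∕h(m+k)² − 1∕h(m)² ≤ k·(1∕h(m+1)² − 1∕h(m)²)`. [folklore] -/
theorem invSq_window_le_mul_first (hmono : ∀ u v : ℕ → ℝ, SeqBox γ u → SeqBox γ v → (∀ j, u j ≤ v j) → B u ≤ B v) (hb : 0 < b)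
    (hlo : ∀ u, SeqBox γ u → b ≤ B u) (hh : SeqBox γ h) (hf : MemFlow B gIR h) (m k : ℕ) :
    1 / h (m + k) ^ 2 - 1 / h m ^ 2 ≤ (k : ℝ) * (1 / h (m + 1) ^ 2 - 1 / h m ^ 2) := by
  induction k with
  | zero => simp
  | succ k ih =>
    have hstep : 1 / h (m + (k + 1)) ^ 2 - 1 / h (m + k) ^ 2 ≤ 1 / h (m + 1) ^ 2 - 1 / h m ^ 2 := by
      rw [show m + (k + 1) = m + k + 1 by ring, hf.2 (m + k), hf.2 m]
      have := increment_anti hmono hb hlo hh hf (show m ≤ m + k by omega)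
      linarith
    push_cast
    linarith

/-- **AT AN INTERIOR PIN THE FIRST INCREMENT IS BELOW THE LEVEL**: for `m ≥ 1`, `1∕h(m+1)² − 1∕h(m)² ≤ 1∕h(m)² − 1∕h(m−1)² ≤ 1∕h(m)²`. [folklore] -/
theorem first_increment_le_level (hmono : ∀ u v : ℕ → ℝ, SeqBox γ u → SeqBox γ v → (∀ j, u j ≤ v j) → B u ≤ B v) (hb : 0 < b)
    (hlo : ∀ u, SeqBox γ u → b ≤ B u) (hh : SeqBox γ h) (hf : MemFlow B gIR h) {m : ℕ} (hm : 1 ≤ m) :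
    1 / h (m + 1) ^ 2 - 1 / h m ^ 2 ≤ 1 / h m ^ 2 := by
  obtain ⟨n, rfl⟩ : ∃ n, m = n + 1 := ⟨m - 1, by omega⟩
  have hprev : 1 / h (n + 1 + 1) ^ 2 - 1 / h (n + 1) ^ 2 ≤ 1 / h (n + 1) ^ 2 - 1 / h n ^ 2 := by
    rw [hf.2 (n + 1), hf.2 n]
    have := increment_anti hmono hb hlo hh hf (show n ≤ n + 1 by omega)
    linarith
  have hpos : 0 < 1 / h n ^ 2 := by have := (hh n).1; positivity
  linarith

/-- **THE LEVEL RATIO AT AN INTERIOR PIN**: for `m ≥ 1` and every `k`, `1∕(k+1) ≤ (h(m+k)∕h(m))²` (i.e. `a_{m+k} ≤ (k+1)·a_m`). [folklore] -/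
theorem ratio_sq_ge_interior (hmono : ∀ u v : ℕ → ℝ, SeqBox γ u → SeqBox γ v → (∀ j, u j ≤ v j) → B u ≤ B v) (hb : 0 < b)
    (hlo : ∀ u, SeqBox γ u → b ≤ B u) (hh : SeqBox γ h) (hf : MemFlow B gIR h) {m : ℕ} (hm : 1 ≤ m) (k : ℕ) :
    1 / ((k : ℝ) + 1) ≤ (h (m + k) / h m) ^ 2 := by
  have h0 := (hh m).1; have hk := (hh (m + k)).1
  have hw := invSq_window_le_mul_first hmono hb hlo hh hf m k
  have hfirst := first_increment_le_level hmono hb hlo hh hf hm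
  -- `a_{m+k} ≤ (k+1) a_m`
  have hle : 1 / h (m + k) ^ 2 ≤ ((k : ℝ) + 1) * (1 / h m ^ 2) := by
    have := mul_le_mul_of_nonneg_left hfirst (Nat.cast_nonneg k)
    nlinarith
  rw [div_pow, div_le_div_iff₀ (by positivity) (by positivity), one_mul]
  have e : 1 / h (m + k) ^ 2 * (h (m + k) ^ 2 * h m ^ 2) = h m ^ 2 := by field_simp
  have e' : ((k : ℝ) + 1) * (1 / h m ^ 2) * (h (m + k) ^ 2 * h m ^ 2) = ((k : ℝ) + 1) * h (m + k) ^ 2 := by field_simp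
  have := mul_le_mul_of_nonneg_right hle (show 0 ≤ h (m + k) ^ 2 * h m ^ 2 by positivity)
  rw [e, e'] at this
  linarith

/-! ## §2 The window-load cap at an interior pin -/

/-- **THE WINDOW-LOAD CAP AT AN INTERIOR PIN.**  Isotone dominated memory with floor, `h` a box solution, `m ≥ 1`, age `k < K`:
`k·L_kh(m+k)³∕2 ≤ ½·√((2k+1)∕(k+1))·(k∕(k+1))` ((E89b) `window_load_le` with `t² ≤ 2 − r`, `r ≥ 1∕(k+1)`). [folklore] -/
theorem window_load_le_interior (hmono : ∀ u v : ℕ → ℝ, SeqBox γ u → SeqBox γ v → (∀ j, u j ≤ v j) → B u ≤ B v)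
    (hL : ∀ k, 0 ≤ L k) (hb : 0 < b) (hlo : ∀ u, SeqBox γ u → b ≤ B u) (hdom : ∀ u, SeqBox γ u → ∑ k ∈ range K, L k * u k ≤ B u)
    (hh : SeqBox γ h) (hf : MemFlow B gIR h) {k : ℕ} (hkK : k < K) {m : ℕ} (hm : 1 ≤ m) :
    (k : ℝ) * (L k * h (m + k) ^ 3 / 2) ≤ 1 / 2 * Real.sqrt ((2 * k + 1) / (k + 1)) * ((k : ℝ) / (k + 1)) := by
  have hpos : ∀ n, 0 < h n := fun n => (hh n).1
  have h0 := hpos m; have h1 := hpos (m + k); have h2 := hpos (m + 2 * k)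
  have hcap := window_load_le hL hb hlo hdom hh hf hkK m
  have hrat := window_ratio_sq_le hmono hb hlo hh hf m k
  have hr := ratio_sq_ge_interior hmono hb hlo hh hf hm k
  set t : ℝ := h (m + k) / h (m + 2 * k) with ht
  set r : ℝ := (h (m + k) / h m) ^ 2 with hr'
  have ht0 : 0 ≤ t := le_of_lt (div_pos h1 h2)
  have hk0 : (0 : ℝ) ≤ k := Nat.cast_nonneg k
  have hr1 : r ≤ 1 := by
    rw [hr', div_pow, div_le_one (pow_pos h0 2)]
    exact pow_le_pow_left₀ h1.le ((strictAnti_of_memFlow hb hlo hh hf).antitone (Nat.le_add_right m k)) 2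
  -- `t ≤ √(2 − r) ≤ √((2k+1)/(k+1))`
  have ht2 : t ≤ Real.sqrt ((2 * k + 1) / (k + 1)) := by
    rw [← Real.sqrt_sq ht0]
    refine Real.sqrt_le_sqrt ?_
    have : (2 : ℝ) - 1 / ((k : ℝ) + 1) = (2 * k + 1) / (k + 1) := by field_simp; ring
    linarith
  -- `1 − r ≤ k/(k+1)`
  have hr2 : 1 - r ≤ (k : ℝ) / (k + 1) := by
    have : (1 : ℝ) - 1 / ((k : ℝ) + 1) = k / (k + 1) := by field_simp; ring
    linarith
  have hs0 : 0 ≤ Real.sqrt ((2 * k + 1) / (k + 1)) := Real.sqrt_nonneg _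
  calc (k : ℝ) * (L k * h (m + k) ^ 3 / 2) ≤ 1 / 2 * t * (1 - r) := hcap
    _ ≤ 1 / 2 * Real.sqrt ((2 * k + 1) / (k + 1)) * (1 - r) :=
        mul_le_mul_of_nonneg_right (mul_le_mul_of_nonneg_left ht2 (by norm_num)) (by linarith)
    _ ≤ 1 / 2 * Real.sqrt ((2 * k + 1) / (k + 1)) * ((k : ℝ) / (k + 1)) := mul_le_mul_of_nonneg_left hr2 (by positivity)

/-- **THE YOUNGEST AGE AT AN INTERIOR PIN CARRIES AT MOST `√6∕8 = 0.3062`** (`k = 1`: `½·√(3∕2)·½`), against `√2∕2` at the infrared pin. [folklore] -/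
theorem young_load_le_interior (hmono : ∀ u v : ℕ → ℝ, SeqBox γ u → SeqBox γ v → (∀ j, u j ≤ v j) → B u ≤ B v)
    (hL : ∀ k, 0 ≤ L k) (hb : 0 < b) (hlo : ∀ u, SeqBox γ u → b ≤ B u) (hdom : ∀ u, SeqBox γ u → ∑ k ∈ range K, L k * u k ≤ B u)
    (hh : SeqBox γ h) (hf : MemFlow B gIR h) (h1K : 1 < K) {m : ℕ} (hm : 1 ≤ m) :
    L 1 * h (m + 1) ^ 3 / 2 ≤ Real.sqrt 6 / 8 := by
  have := window_load_le_interior hmono hL hb hlo hdom hh hf h1K hm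
  simp only [Nat.cast_one, one_mul] at this
  have e : Real.sqrt ((2 * 1 + 1) / (1 + 1)) = Real.sqrt 6 / 2 := by
    rw [show ((2 : ℝ) * 1 + 1) / (1 + 1) = 6 / 2 ^ 2 by norm_num, Real.sqrt_div' _ (by norm_num), Real.sqrt_sq (by norm_num)]
  rw [e] at this
  linarith

/-! ## §3 The top entry at an interior pin -/

/-- **THE TOP ENTRY AT AN INTERIOR PIN IS AT MOST ONE HALF**: for `m ≥ 1`, `Σ_{k<K} L_kh(m+k)³∕2 ≤ ½` — the budget of the previous scale
(`Σ_k L_kh(m+k) ≤ a_m − a_{m−1}`, domination at the history `h(m+·)`) with `h(m+k)² ≤ h(m)² = 1∕a_m` and `a_m − a_{m−1} < a_m`. [folklore] -/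
theorem top_entry_le_half_interior (hL : ∀ k, 0 ≤ L k) (hb : 0 < b) (hlo : ∀ u, SeqBox γ u → b ≤ B u)
    (hdom : ∀ u, SeqBox γ u → ∑ k ∈ range K, L k * u k ≤ B u) (hh : SeqBox γ h) (hf : MemFlow B gIR h) {m : ℕ} (hm : 1 ≤ m) :
    ∑ k ∈ range K, L k * h (m + k) ^ 3 / 2 ≤ 1 / 2 := by
  have hpos : ∀ n, 0 < h n := fun n => (hh n).1
  have hanti := (strictAnti_of_memFlow hb hlo hh hf).antitone
  obtain ⟨n, rfl⟩ : ∃ n, m = n + 1 := ⟨m - 1, by omega⟩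
  -- the budget of the previous scale
  have hbud : ∑ k ∈ range K, L k * h (n + 1 + k) ≤ 1 / h (n + 1) ^ 2 - 1 / h n ^ 2 := by
    rw [hf.2 n]; have := hdom _ (seqBox_shift hh (n + 1)); linarith
  have hprev : 0 < 1 / h n ^ 2 := by have := hpos n; positivity
  -- each cube against the square at the pin
  have hcube : ∀ k ∈ range K, L k * h (n + 1 + k) ^ 3 / 2 ≤ (h (n + 1) ^ 2 / 2) * (L k * h (n + 1 + k)) := by
    intro k _
    have hk := hpos (n + 1 + k)
    have hsq : h (n + 1 + k) ^ 2 ≤ h (n + 1) ^ 2 := pow_le_pow_left₀ hk.le (hanti (Nat.le_add_right (n + 1) k)) 2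
    have := mul_le_mul_of_nonneg_left hsq (mul_nonneg (hL k) hk.le)
    nlinarith
  calc ∑ k ∈ range K, L k * h (n + 1 + k) ^ 3 / 2 ≤ ∑ k ∈ range K, (h (n + 1) ^ 2 / 2) * (L k * h (n + 1 + k)) := sum_le_sum hcube
    _ = (h (n + 1) ^ 2 / 2) * ∑ k ∈ range K, L k * h (n + 1 + k) := by rw [mul_sum]
    _ ≤ (h (n + 1) ^ 2 / 2) * (1 / h (n + 1) ^ 2 - 1 / h n ^ 2) := mul_le_mul_of_nonneg_left hbud (by positivity)
    _ ≤ (h (n + 1) ^ 2 / 2) * (1 / h (n + 1) ^ 2) := mul_le_mul_of_nonneg_left (by linarith) (by positivity)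
    _ = 1 / 2 := by have := (hpos (n + 1)).ne'; field_simp

end Summit.QuantumFields.BalabanUV.Beta.EriceRemainderEnclosureHistoryAutonomyComparisonAgeCompositionInteriorPins

end
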